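import Literature.NumberTheory.Automorphic.ReciprocityGLnProofs
import Literature.NumberTheory.Automorphic.AdicCompletionLocalField
import Literature.NumberTheory.GaloisRepresentations.LocalGaloisGroup
import HarnessLib

/-!
# Varma 2024, Theorem 1 at the unramified places, in trace form

Topic `Literature/NumberTheory/Automorphic`, namespace `Literature.NumberTheory.Automorphic.Varma2024`
(next to `corollary93_unramified` of `ReciprocityGLnProofs` and `theorem12_trace_eq_and_precI` of
`VarmaLocalGlobalPrecI`).

Source (I. Varma, *Local-global compatibility for regular algebraic cuspidal automorphic
representations when `ℓ ≠ p`*, Forum Math. Sigma 12 (2024) e21 = arXiv:1411.2520), read against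
the journal text: §1, p. 2, opens "Let `F` be an imaginary CM (or totally real) field, and let `π`
be a regular algebraic … cuspidal automorphic representation of `GL_n(𝔸_F)`", recalls the
continuous semisimple `r_{p,ı}(π)` of Harris–Lan–Taylor–Thorne [10] and Scholze [18], and states
**Theorem 1.** "Keeping the notation of the previous paragraph, let `v ∤ p` be a prime of `F`. Then
`WD(r_{p,ı}(π)|_{G_{F_v}})^{ss} = ı⁻¹ rec_{F_v}(π_v ⊗ |det|_v^{(1-n)/2})^{ss}`."  So Theorem 1 AS
PRINTED covers `F` imaginary CM **and** `F` totally real, at every `v ∤ p`.  **Theorem 2** (p. 2) is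
the `≺`-version "`WD(r_{p,ı}(π)|_{G_{F_v}})^{Frob-ss} ≺ ı⁻¹ rec_{F_v}(π_v ⊗ |det|_v^{(1-n)/2})`", and
**Corollary 9.3** (p. 32; `E` totally real or CM, every `v ∣ ℓ ≠ p`) states only the `≺`-relation,
"deduced from Theorem 9.2 in conjunction with Lemma 1 of [21] [Sorensen's patching lemma] using the
same argument as in Theorem VII.1.9 of [11] [Harris–Taylor]".  CAUTION on `≺` (**Definition 8.2**,
p. 23): for each class `ω` of
irreducible representations of `W_{F_v}` with open kernel *up to unramified twist*,
`σ[ω]^{Frob-ss} ≅ ⊕_i s_i ⊗ Sp(m_{i,ω}(σ,N))` with `s_i ∈ ω`, and `(σ,N) ≺ (σ',N')` iff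
`m_{1,ω} + ⋯ + m_{i,ω}` of `(σ,N)` is `≤` that of `(σ',N')` for all `ω`, `i`.  This relation does NOT
by itself entail `σ^{ss} ≅ σ'^{ss}` (the unramified twists `s_i` are not compared; cf. Lemma 8.4,
p. 24 = [BC] Lemma 6.5.3: given `σ^{ss} ≅ σ'^{ss}`, `≺ ⟺ ≺_I`).  At a place where `π_v` is unramified the
right-hand side is `⊕_j χ_j ⊗ Sp(1)` with all `χ_j` in the class of the trivial representation, so `≺`
forces `σ = σ[1]` and `N = 0`, i.e. `r_{p,ı}(π)` unramified at `v` (Thm. 9.2: "In particular, if `π`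
and `F` are unramified at `v`, then `r_{p,ı}(π)` is unramified") — but NOT the eigenvalues of
Frobenius, which are the content of Theorem 1 (semisimplifications).  The fact below therefore
rests on **Theorem 1 (p. 2)** for both kinds of fields (an earlier version of this docstring derived
the totally real case from Cor. 9.3 through a reading of Def. 8.2 that the printed definition does not
support; the `[cite]` locators were and are correct).

## What is vendored (`theorem1_unramified_traces`), and why this rendering

At a place `v ∤ ℓ` where `π_v` is **unramified** with Satake parameter `α`,
`rec_{K_v}(π_v ⊗ |det|^{(1-n)/2})` is the direct sum of the unramified characters `χ_j` of `W_{K_v}`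
whose values on an arithmetic Frobenius, read through `ı⁻¹`, are the roots `b_j` of the tree's
`arithFrobPolyOfSatake ı q_v n α` (the normalisation of `ReciprocityGLn`, review 13, already used by
`HarrisLanTaylorThorne2016.IsCompatible` and `corollary93_unramified`).  Equality of semisimplified
Weil-group representations is equality of traces, and the `ℓ`-adic representation `r|_{W_{K_v}}` has
the same traces as the Weil–Deligne representation `WD(r|_{G_{K_v}})` attached to it by
Grothendieck–Deligne (the unipotent factor `exp(t N)` does not change traces).  So Theorem 1 at such
`v` says exactly: **every `σ ∈ Γ_{K_v}` acting on the residue field as the `d`-th power of the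
arithmetic Frobenius (`IsFrobPow σ d`, i.e. `σ ∈ W_{K_v}` of degree `d`) has
`tr r(σ) = ∑_j b_j ^ d`.**  This is the statement vendored here, with the quantifier prefix of
`corollary93_unramified` (K totally real or CM — both covered by Thm. 1 as printed, p. 2 —,
`π` regular algebraic cuspidal, `∀ hcpt`, and `r_{ℓ,ı}(π)` presented as ANY continuous semisimple `r`
with HLTT's property `IsCompatible`, all such `r` being isomorphic by Thm. A's uniqueness —
in the tree a theorem, `theoremA_uniqueness_of_chebotarev` with `chebotarev_artinRep_holds` — and
traces being isomorphism-invariant).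

* It uses NO Weil–Deligne or local-Langlands vocabulary (compare `theorem12_trace_eq_and_precI`,
  which renders Theorems 1 AND 2 at all `v ∤ ℓ` through `LocalLanglandsDatum`, `IsWeilDeligneOfLadic`,
  `IsTransportAlong`, `PrecI`), so that it can be CONSUMED by elementary means: the crux line
  `Summits/Langlands/Langlands/Cruxes/GaloisRepOfRegularAlgebraic/Lines/Sketch.lean` proves
  (landed stubs `stub_localRigidity`, `stub_satakeGap`, `stub_monodromyGap`, `stub_inertiaTraces`,
  `stub_gapTransport` under `Summits/Langlands/Langlands/Theorems/`) that this fact together with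
  HLTT's Thm. A (existence) implies **lang.S27** (`exists_galoisRep_of_regularAlgebraic`), i.e. that
  `corollary93_unramified` — which stands for Theorem 1 AND Theorem 2 (`≺`, Varma §§8–9: K-types of
  Schneider–Zink, the finer patching) — can be replaced in the cone of lang.S27 by Theorem 1 alone:
  at an unramified `π_v` the Satake parameters of a cuspidal `π` have no two entries in ratio `q_v`
  (Jacquet–Shalika Cor. 2.5), and then Grothendieck's monodromy operator of any `ℓ`-adic `r` with
  these traces vanishes.
* It is WEAKER than the printed Theorem 1 / Cor. 9.3 (only unramified `π_v`, only traces).  In the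
  tree it IS implied by `corollary93_unramified` — the sibling PROOFS file
  `VarmaUnramifiedWeilTracesProofs` proves
  `Varma2024.theorem1_unramified_traces_of_corollary93_unramified :
  corollary93_unramified → theorem1_unramified_traces` (decomposition group of `K_v` at the prime
  `adicCompletionPrime K v`, Frobenius degrees, `r` trivial on inertia, `charpoly r(Frob_v) =
  arithFrobPolyOfSatake …`, and `tr (u ^ d) = ∑ roots(charpoly u) ^ d` for `d ∈ ℤ`), hence by
  **lang.S27** through `Varma2024.corollary93_unramified_of_regularAlgebraic`
  (`ReciprocityGLnUniquenessHolds`); the converse implication is the content of the crux line just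
  described.  It neither implies nor is implied in the tree by `theorem12_trace_eq_and_precI` (a)
  (which would need the unramified case of the local Langlands datum and the Grothendieck–Deligne
  trace comparison).

Not proved here (XL: ordinary `p`-adic automorphic forms on `U(n,n)` and the Bernstein centre,
Varma §§5–7; Prop. 7.1 / arXiv Prop. 8.1); proved FROM `corollary93_unramified` in
`VarmaUnramifiedWeilTracesProofs`, and from the `2n`-dimensional output of Thm. 5.1 + Prop. 7.1
(taken as a raw hypothesis) with the two Arthur–Clozel base-change leaves in
`VarmaTheorem1BaseChangeProofs` — see "Proved chain" in the status section below.

## Status of the fact (review against the source, 2026-08-16)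

* **Faithful, and not stronger than the source.**  Theorem 1 as printed (p. 2, quoted above) is
  about the representation `r_{p,ı}(π)` of [HLTT]/[Scholze] for `F` imaginary CM or totally real and
  every `v ∤ p`; the statement below quantifies instead over every continuous semisimple `r` with
  Harris–Lan–Taylor–Thorne's characterising property `IsCompatible π ι r` (Thm. A as published,
  p. 3; existence = Cor. 7.14, p. 232), and any two such `r` are isomorphic by the uniqueness clause
  of Thm. A, which
  is PROVED in the tree (`HarrisLanTaylorThorne2016.theoremA_uniqueness_holds`,
  `ReciprocityGLnUniquenessHolds`, from the Chebotarev density theorem); traces on `Γ_{K_v}` are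
  invariant under isomorphism.  The Frobenius convention (`IsFrobPow σ 1` = arithmetic Frobenius,
  `b_j` = roots of `arithFrobPolyOfSatake`, `b_j ^ d`) is the one of `IsCompatible` /
  `HasFrobCharpolyAt`; degree `0` (inertia: `tr = n`) and negative degrees are included and are what
  Theorem 1 gives there (at an unramified `π_v`, `WD(r)^{ss} = (ρ^{ss}, 0)` with `ρ^{ss}` a sum of
  unramified characters, and `tr r(σ) = tr ρ(σ)` for every `σ ∈ W_{K_v}`: `r(σ) = ρ(σ) u(σ)` with
  `u(σ) ∈ exp(ℚ_ℓ N)` (Grothendieck–Deligne, Tate §4.2); in degree `0`, `ρ(σ)` has finite order and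
  commutes with the unipotent `u(σ)`; in degree `d ≠ 0`, `tr (ρ(σ) N ^ k) = 0` for `k ≥ 1` because
  `ρ(σ) N ρ(σ)⁻¹ = q_v^{±d} N`).
* **Apex-sized, not a piece of a printed proof.**  What the statement adds to `IsCompatible` is the
  unramified `π_v` over the finitely many rational primes `q ≠ ℓ` above which `π` ramifies at some
  OTHER place of `K`; that is Varma's Theorem 1 proper, and no layer of its proof below Prop. 7.1
  (§§2–7: compactified `U(n,n)` Shimura varieties and their ordinary loci after [HLTT], `p`-adic
  automorphic forms, the Bernstein centre acting through the Hecke algebras — Prop. 7.1 —, local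
  Langlands for `GL_n` at ramified `π_v`) is stateable in the tree today (see "lower layers" in
  `ReciprocityGLnProofs`); the layers ABOVE it (§9 and the deduction of Cor. 9.3) are, and are proved
  — next bullet but one.  Everything Thm. A yields unconditionally — the conclusion at the places
  over good rational primes, at all but finitely many places, at a place alone over its rational
  prime, and in ranks `n ≤ 1` (Weil 1956 + the proved uniqueness clause) — is proved Summit-side in
  `Summits/Langlands/Langlands/Theorems/IrreducibilityBySelfDualityVarmaWeilTracesUnramified.lean`;
  here `trace_eq_of_isCompatible_of_mem_inertia` records the degree-`0` instance over good primes.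
* **One debt with `corollary93_unramified` and lang.S27, not three.**  In the tree
  `corollary93_unramified → theorem1_unramified_traces`
  (`theorem1_unramified_traces_of_corollary93_unramified`, sibling Proofs file); conversely the
  statement on non-zero degrees gives back `corollary93_unramified` (Summit-side
  `GaloisRepOfRegularAlgebraic.corollary93_unramified_of_weilTraces`: Satake gap of a cuspidal `π`,
  Grothendieck's monodromy theorem, local rigidity); and `corollary93_unramified ↔
  exists_galoisRep_of_regularAlgebraic` granted `theoremA_existence`
  (`corollary93_unramified_iff_regularAlgebraic`, `ReciprocityGLnUniquenessHolds`).  Hence the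
  discharge of this fact is the one-liner
  `theorem1_unramified_traces_of_corollary93_unramified corollary93_unramified_holds` once the latter
  exists, and nothing short of Varma's Theorem 1 discharges any of the three.
* **Proved chain in the tree (2026-08-16): everything above the Shimura-variety output.**  The
  printed proof of Thm. 1 at an unramified `π_v` is Thm. 5.1 + Prop. 7.1 (the `2n`-dimensional
  `R_p(Π)`, `Π ⊂ Ind(π^∞‖det‖^N × 1)` inside the ordinary `p`-adic forms on `U(n,n)`, with local-global
  compatibility above the rational primes split in `F₀`) ⇒ (9.1) by the group-theoretic Prop. 9.1
  (= HLTT Prop. 7.12) ⇒ Thm. 9.2 ⇒ Cor. 9.3 / Thm. 1 over any CM or totally real `K` by quadratic base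
  change to `K(√-D)` and descent (Harris–Taylor VII.1.9).  All of this ABOVE Prop. 7.1 is formalized
  as theorems with raw hypotheses (no further named fact): `VarmaTheorem92Engine`
  (`Varma2024.theorem92_engine`: Prop. 9.1 with the Frobenius-power elements `σ (φ^d)⁻¹ ∈ I_𝔓`,
  `μ(σ) = q_v^{-2d}`, on top of the proved `prop712Hausdorff_holds`), `VarmaTheorem92TracesProofs`
  (`theorem92_traces_of_prop71 (h57)`: display (9.1) in trace form, all degrees `d ∈ ℤ`),
  `VarmaTheorem1BaseChangeProofs` (**`theorem1_unramified_traces_of_prop71 (h57) (harch) (hBC) :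
  theorem1_unramified_traces`**: member `K(√-D)` with `v` completely split, strong base change,
  Chebotarev identification, descent of the trace identity), and one level up
  `VarmaCorollary93BaseChangeProofs` (`theorem1_unramified_traces_of_theorem92 (h92) (harch) (hBC)`,
  `corollary93_unramified_of_theorem92`, with `h92` = journal Thm. 9.2 at unramified `π_v`).  Here
  `h57` = Thm. 5.1 + Prop. 7.1 (p. 20) for the family `R_{p,ı}(π, N)` in the shape of
  `HarrisLanTaylorThorne2016.corollary627_splitOrUnramified` plus Prop. 7.1's first alternative
  (root multisets of `charpoly R_N(σ)` at Frobenius-power elements over `q` split in `F₀`, `π_v`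
  unramified, NO condition on `π` at the other places over `q`), `harch` =
  `ArthurClozel1989_strongLifting_archimedean`, `hBC` = `ArthurClozel1989_strongLifting_cuspidal`.
  So the exact residue of `theorem1_unramified_traces_holds` is {a named fact for `h57` — not in
  the tree: the `U(n,n)` apex, XL —, the two Arthur–Clozel facts}; Thm. 2 / the `≺`-half of Thm. 9.2
  (Cor. 8.12, Schneider–Zink types) is not needed for this fact, nor — Summit-side, via
  `IrreducibilityBySelfDualityVarmaWeilTracesUnramified.iff_corollary93_unramified` — for
  `corollary93_unramified` or lang.S27.

## References

* I. Varma, Forum Math. Sigma 12 (2024) e21, doi:10.1017/fms.2024.7 (arXiv:1411.2520): Thm. 1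
  (p. 2), Thm. 5.1, Prop. 7.1 (p. 20), Prop. 9.1, Thm. 9.2 and its proof with (9.1) (pp. 30–31),
  Cor. 9.3 (p. 32); arXiv Thm. 10.2 and its proof (p. 24: "Let `𝔉` contain all
  elements `σ_v ∈ W_{F_v}` which project to a power of Frobenius …"). [VarmaFMS2024]
* M. Harris, K.-W. Lan, R. Taylor, J. Thorne, Res. Math. Sci. 3:37 (2016), Thm. A (uniqueness
  clause, p. 3). [HarrisLanTaylorThorneRMS2016]
* J. Tate, *Number theoretic background*, Corvallis 1979, (1.4.1) (Weil group, degree), §4.1–4.2.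
  [TateCorvallis1979]
-/

noncomputable section

open scoped MatrixGroups Matrix NumberField Polynomial
open NumberField IsDedekindDomain Field Polynomial

namespace Literature.NumberTheory.Automorphic

namespace Varma2024

open Literature.NumberTheory.GaloisRepresentations

/-- **Varma 2024, Theorem 1 (printed for `F` imaginary CM or totally real, p. 2; cf. Cor. 9.3) at
the unramified places, in trace form.**  Let `K` be totally real or CM, `π` a regular algebraic
cuspidal automorphic representation of `GL_n(𝔸_K)`, `ℓ` a prime, `ı : ℚ̄_ℓ ≃ ℂ`, and
`r : Γ_K → GL_n(ℚ̄_ℓ)` continuous semisimple with Harris–Lan–Taylor–Thorne's property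
(`IsCompatible`, i.e. `r ≅ r_{ℓ,ı}(π)` by the uniqueness clause of Thm. A, proved in the tree as
`theoremA_uniqueness_holds`).  Let `v ∤ ℓ` be a finite place at which `π` has Satake parameter `α`,
and let `b_1, …, b_n ∈ ℚ̄_ℓ` be the roots of `arithFrobPolyOfSatake ı q_v n α` (the predicted
arithmetic-Frobenius eigenvalues).  Then every `σ ∈ Γ_{K_v}` which acts on the residue field of
`\bar K_v` as the `d`-th power of the arithmetic Frobenius (`IsFrobPow σ d`, `d ∈ ℤ`; these are the
elements of the Weil group `W_{K_v}`, of degree `d`) satisfies `tr r(σ) = ∑_j b_j ^ d` — i.e.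
`(r|_{W_{K_v}})^{ss} ≅ ⊕_j χ_j` with `χ_j` unramified, `χ_j(Frob_v) = b_j`, which is the printed
"`WD(r_{p,ı}(π)|_{G_{F_v}})^{ss} = ı⁻¹rec_{F_v}(π_v ⊗ |det|_v^{(1-n)/2})^{ss}`" at an unramified
`π_v` (the unipotent part of Grothendieck's monodromy does not affect traces).  Theorem 2 / `≺` is
NOT part of this statement.  Named fact (D-0014), not proved here; see the module docstring for the
relation to `corollary93_unramified` and `theorem12_trace_eq_and_precI`.
[cite: VarmaFMS2024, Thm. 1 (p. 2) and Cor. 9.3 (p. 32)]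
[cite: HarrisLanTaylorThorneRMS2016, Thm. A (uniqueness clause, p. 3)] -/
def theorem1_unramified_traces : Prop :=
  ∀ {n : ℕ} {K : Type} [Field K] [NumberField K] (hcpt : isCompact_glFiniteIntegralLevel n K),
    IsTotallyReal K ∨ IsCMField K →
    ∀ (π : CuspidalAutomorphicRepData n K hcpt), π.1.IsRegularAlgebraic →
    ∀ (ℓ : ℕ) [Fact ℓ.Prime] (ι : PadicAlgCl ℓ ≃+* ℂ) (r : FramedGaloisRep K (PadicAlgCl ℓ) n),
      r.toGaloisRep.IsSemisimple → HarrisLanTaylorThorne2016.IsCompatible π.1 ι r →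
      ∀ (v : HeightOneSpectrum (𝓞 K)), ((ℓ : ℕ) : 𝓞 K) ∉ v.asIdeal →
      ∀ (α : Multiset ℂ), π.1.HasSatakeParamAt v α →
      ∀ (σ : absoluteGaloisGroup (v.adicCompletion K)) (d : ℤ), IsFrobPow σ d →
        (((r.toLocal v) σ : GL (Fin n) (PadicAlgCl ℓ)) : Matrix (Fin n) (Fin n) (PadicAlgCl ℓ)).trace
          = ((arithFrobPolyOfSatake ι v.residueCard n α).roots.map fun b => b ^ d).sum

/-- At a place over a rational prime `q ≠ ℓ` above which `π` is unramified, HLTT-compatibility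
ALREADY gives the conclusion of `theorem1_unramified_traces` on the elements of degree `0` lying in
the global inertia groups: there `r` is unramified, so inertia has trace `n = ∑_j b_j ^ 0`.  Recorded
as the cheap consistency check of the rendering (the arithmetic-Frobenius normalisation of
`arithFrobPolyOfSatake` is the one of `IsCompatible`): for `σ` in an inertia group above such a
place, `tr r(σ) = n`. [folklore] -/
theorem trace_eq_of_isCompatible_of_mem_inertia {n : ℕ} {K : Type} [Field K] [NumberField K]
    {hcpt : isCompact_glFiniteIntegralLevel n K} {ℓ : ℕ} [Fact ℓ.Prime]
    (π : CuspidalAutomorphicRepData n K hcpt) (ι : PadicAlgCl ℓ ≃+* ℂ)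
    (r : FramedGaloisRep K (PadicAlgCl ℓ) n) (hc : HarrisLanTaylorThorne2016.IsCompatible π.1 ι r)
    {q : ℕ} (hq : q.Prime) (hqℓ : q ≠ ℓ) (hπq : π.1.IsUnramifiedAbove q)
    {v : HeightOneSpectrum (𝓞 K)} (hv : ((q : ℕ) : 𝓞 K) ∈ v.asIdeal)
    {𝔓 : Ideal (absIntegers (𝓞 K) K)} (h𝔓 : 𝔓 ∈ v.primesAbove)
    {σ : absoluteGaloisGroup K} (hσ : σ ∈ 𝔓.inertia (absoluteGaloisGroup K)) :
    ((r σ : GL (Fin n) (PadicAlgCl ℓ)) : Matrix (Fin n) (Fin n) (PadicAlgCl ℓ)).trace = n := by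
  obtain ⟨α, hα⟩ := hπq v hv
  have hunr : r.IsUnramifiedAt v := (hc q hq hqℓ hπq v hv α hα).1
  rw [hunr 𝔓 h𝔓 σ hσ, Units.val_one, Matrix.trace_one, Fintype.card_fin]

end Varma2024

end Literature.NumberTheory.Automorphic

end
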